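import Literature.Topology.FourManifolds.HandleRealise
import Literature.Topology.FourManifolds.OneHandlebodyBoundaryFundamentalGroup
import Literature.Topology.FourManifolds.LickorishWallaceProofs
import HarnessLib

/-!
# Every automorphism of `π₁` of a `3`-dimensional handlebody is induced by a based
# self-diffeomorphism (Zieschang 1964 / Griffiths 1964, by Laudenbach–Poénaru's handle slides)

Topic `Literature/Topology/FourManifolds`; support file for the named fact
`Literature.Topology.FourManifolds.GriffithsExtension` (`HandlebodyKernelExtension.lean`;
H. B. Griffiths, *Automorphisms of a 3-dimensional handlebody*, Abh. Math. Sem. Univ. Hamburg 26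
(1964), main theorem).  **Everything here is proved; no definition and no named fact is
introduced.**

**Theorem** (`HasHandleDecomposition.exists_diffeomorph_mapOfEq_eq_of_dim_three`,
`IsHandlebody.exists_diffeomorph_mapOfEq_eq`).  *Let `V` be a genus-`k` handlebody (a compact
connected orientable smooth `3`-manifold with boundary with one `0`-handle and `k` `1`-handles,
`IsHandlebody k V`) and `z ∈ ∂V`.  Then every automorphism `θ` of `π₁(V, z)` is induced by a
self-diffeomorphism `G` of `V` fixing `z`: `G_# = θ`.*  This is the theorem of Zieschang
(*Über einfache Kurven auf Vollbrezeln*, Abh. Math. Sem. Univ. Hamburg 25 (1962); *Alternierende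
Produkte in freien Gruppen*, ibid. 27 (1964)) and Griffiths (loc. cit., §§3–5): the natural map
from the homeotopy group of the handlebody `V_k` to `Aut F_k = Aut π₁(V_k)` is onto (restated in
D. McCullough, A. Miller, *Homeomorphisms of 3-manifolds with compressible boundary*, Mem. AMS 344
(1986), §1, and S. Hensel, *A primer on handlebody groups* (2020), Thm. 6.2: handle slides,
permutations and spins realise Nielsen's generators).  It is the "realisation half" of
Griffiths' extension theorem; the other half (boundary diffeomorphisms acting as the identity on
`π₁ V` extend) is Dehn's-lemma territory and is not touched here.

## Proof

The tree's proof of Laudenbach–Poénaru's Lemma 2 (`HandleRealise.lean`,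
`HasHandleDecomposition.exists_realise_autGenerators`: on a `4`-dimensional `1`-handlebody every
elementary Nielsen automorphism of `π₁` in the basis of the cores of the `1`-handles is induced by
a slide or a flip of one handle — Milnor's handle-extension diffeomorphism of a diffeotopy of the
level below the top handle dragging one of its feet) is written for manifolds of dimension
`n + 1` with `n ≥ 2` in all its geometric parts (`Cobordism.IsNiceMorseFunction.handle_realise`,
`SlideRealisation.lean`, `FlipRealisation.lean`, `PointPushDiffeotopy.lean`), the dimension `4`
entering only through two inputs of the final assembly: the isomorphism `π₁ ∂V ≅ π₁ V`
(inner automorphisms realised by point pushes of the boundary) and the connectedness of `∂V`.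
In dimension `3` the first is replaced by the **surjectivity** of `π₁(∂V, z) → π₁(V, z)`
(`HasHandleDecomposition.surjective_inclHom_boundary`, `n ≥ 2`,
`OneHandlebodyBoundaryFundamentalGroup.lean`) — all the argument uses — and the second by
`IsHandlebody.connectedSpace_boundary_holds` (`LickorishWallaceProofs.lean`).  With these, §§1–3
below rerun the assembly at `n = 2` at a prescribed boundary base point, and §4 passes from the
generating set to all of `Aut π₁(V, z)` (the realised automorphisms form a subgroup).

## References

* H. Zieschang, *Alternierende Produkte in freien Gruppen*, Abh. Math. Sem. Univ. Hamburg 27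
  (1964) 13–31. [Zieschang1964]
* H. B. Griffiths, *Automorphisms of a 3-dimensional handlebody*, Abh. Math. Sem. Univ. Hamburg 26
  (1964) 191–210, §§3–5. [GriffithsHB1964Handlebody]
* S. Hensel, *A primer on handlebody groups*, Handbook of Group Actions V (2020), Thm. 6.2.
  [Hensel2020HandlebodyPrimer]
* F. Laudenbach, V. Poénaru, *A note on 4-dimensional handlebodies*, Bull. Soc. Math. France
  100 (1972) 337–344, §2, proof of Lemma 2 (pp. 339–340). [LaudenbachPoenaruBSMF1972]
* J. Milnor, *Lectures on the h-cobordism theorem* (1965), Thms. 3.13, 4.8. [MilnorHCobordism1965]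
* A. Hatcher, *Algebraic Topology* (2002), §1.1, Lemma 1.19, Example 1.22. [HatcherAT2002]
-/

open scoped Manifold ContDiff Topology unitInterval
open Set Function Metric

noncomputable section

namespace Literature.Topology.FourManifolds

open BoundaryManifold Literature.AlgebraicTopology Literature.AlgebraicTopology.FundamentalGroup

universe u

variable {V : Type u} [TopologicalSpace V] [T2Space V] [SecondCountableTopology V] [CompactSpace V]
  [ConnectedSpace V] [ChartedSpace (EuclideanHalfSpace 3) V] [IsManifold (𝓡∂ 3) ∞ V]

/-! ### §1 Inner automorphisms at a boundary point of a `3`-dimensional `1`-handlebody -/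

/-- **Inner automorphisms of `π₁` of a `3`-dimensional `1`-handlebody are induced by based
self-diffeomorphisms.**  Let `V` be a compact connected smooth `3`-manifold with boundary having a
handle decomposition with one `0`-handle and `k` `1`-handles and `z ∈ ∂V`.  Then for every
`c ∈ π₁(V, z)` there is a self-diffeomorphism `G` of `V` with `G z = z` and `G_# x = c x c⁻¹` for
all `x`.  Proof: `c = i_# [γ]` for a loop `γ` of `∂V` at `z` (`π₁(∂V, z) → π₁(V, z)` is onto for
`1`-handlebodies of dimension `≥ 3`, `HasHandleDecomposition.surjective_inclHom_boundary`); push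
`z` around `γ` by a diffeotopy `ψ` of `∂V` (Hirsch, Ch. 8 §1); `ψ₁` is diffeotopic to the identity,
so extends to `G` over `V` (collar, `BoundaryData.diffeoExtends_of_isDiffeotopicToId_holds`);
`(ψ₁)_# = [γ](·)[γ]⁻¹` on `π₁(∂V, z)` (Hatcher, Lemma 1.19) and `G|∂V = ψ₁`.
[cite: LaudenbachPoenaruBSMF1972, §2, p. 339] [cite: HirschDT1976, Ch. 8 §1, Thm. 1.3; Ch. 8 §2, proof of Thm. 2.3]
[cite: HatcherAT2002, Lemma 1.19] -/
theorem exists_diffeomorph_mapOfEq_eq_conj_of_dim_three {k : ℕ}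
    (hk : HasHandleDecomposition 2 V (handleCount 1 k))
    (z : V) (hz : z ∈ (𝓡∂ 3).boundary V) (c : FundamentalGroup V z) :
    ∃ (G : V ≃ₘ⟮𝓡∂ 3, 𝓡∂ 3⟯ V) (hGz : G z = z),
      ∀ x : FundamentalGroup V z,
        FundamentalGroup.mapOfEq (⟨G, G.continuous⟩ : C(V, V)) hGz x = c * x * c⁻¹ := by
  haveI : CompactSpace ((𝓡∂ (2 + 1)).boundary V) := compactSpace_boundary 2 V
  have hsurj : Function.Surjective (VanKampen.inclHom ((𝓡∂ (2 + 1)).boundary V) z hz) :=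
    hk.surjective_inclHom_boundary (handleCount_zero 1 k) (fun j hj => handleCount_of_two_le 1 k hj)
      le_rfl hz
  -- `c` comes from a loop `γ` of the boundary
  obtain ⟨y, hy⟩ := hsurj c
  let γ : Path (⟨z, hz⟩ : (𝓡∂ (2 + 1)).boundary V) ⟨z, hz⟩ := (FundamentalGroup.toPath y).out
  have hγy : FundamentalGroup.fromPath (Path.Homotopic.Quotient.mk γ) = y := Quotient.out_eq _
  -- push `z` around `γ` inside the boundary
  obtain ⟨D, K, -, -, -, -, -, h1, hhom⟩ :=
    exists_diffeotopy_apply_eq_trackPath_homotopic (n := 2) γ isOpen_univ (subset_univ _)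
  have hψd : Diffeomorph.IsDiffeotopicToId (D.stage 1) := ⟨D, rfl⟩
  have hψz : D.stage 1 ⟨z, hz⟩ = ⟨z, hz⟩ := h1
  -- extend the end stage over `V` (collar)
  obtain ⟨G, hG⟩ := BoundaryData.diffeoExtends_of_isDiffeotopicToId_holds 2 V
    (BoundaryManifold.boundaryData 2 V) (D.stage 1) hψd
  have hGincl : ∀ w : (𝓡∂ (2 + 1)).boundary V, G (w : V) = ((D.stage 1 w : (𝓡∂ (2 + 1)).boundary V) : V) :=
    fun w => congrFun hG w
  have hGz : G z = z := by
    have h := hGincl ⟨z, hz⟩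
    rw [hψz] at h
    exact h
  refine ⟨G, hGz, fun x => ?_⟩
  obtain ⟨a, rfl⟩ := hsurj x
  -- `G_# ∘ i_# = i_# ∘ ψ_#`
  let ψCM : C((𝓡∂ (2 + 1)).boundary V, (𝓡∂ (2 + 1)).boundary V) := ⟨D.stage 1, (D.stage 1).continuous⟩
  let GCM : C(V, V) := ⟨G, G.continuous⟩
  have hcomp : GCM.comp (VanKampen.incl ((𝓡∂ (2 + 1)).boundary V)) =
      (VanKampen.incl ((𝓡∂ (2 + 1)).boundary V)).comp ψCM :=
    ContinuousMap.ext fun w => hGincl w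
  have hnat : FundamentalGroup.mapOfEq GCM hGz (VanKampen.inclHom ((𝓡∂ (2 + 1)).boundary V) z hz a) =
      VanKampen.inclHom ((𝓡∂ (2 + 1)).boundary V) z hz (FundamentalGroup.mapOfEq ψCM hψz a) := by
    show FundamentalGroup.mapOfEq GCM hGz
        (FundamentalGroup.mapOfEq (VanKampen.incl ((𝓡∂ (2 + 1)).boundary V)) rfl a) =
      FundamentalGroup.mapOfEq (VanKampen.incl ((𝓡∂ (2 + 1)).boundary V)) rfl
        (FundamentalGroup.mapOfEq ψCM hψz a)
    rw [← FundamentalGroup.mapOfEq_comp_apply (VanKampen.incl ((𝓡∂ (2 + 1)).boundary V)) GCM rfl hGz a,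
      FundamentalGroup.mapOfEq_congr hcomp,
      ← FundamentalGroup.mapOfEq_comp_apply ψCM (VanKampen.incl ((𝓡∂ (2 + 1)).boundary V)) hψz rfl a]
  -- `ψ_#` is conjugation by the class of the track, which is `[γ]`
  let F : ContinuousMap.Homotopy (ContinuousMap.id ((𝓡∂ (2 + 1)).boundary V)) ψCM :=
    { toFun := fun p => D.toFun p.1 p.2
      continuous_toFun := D.contMDiff_uncurry_toFun.continuous.comp
        ((continuous_subtype_val.comp continuous_fst).prodMk continuous_snd)
      map_zero_left := fun w => by
        show D.toFun ((0 : I) : ℝ) w = w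
        rw [Set.Icc.coe_zero, D.toFun_zero]; rfl
      map_one_left := fun w => rfl }
  let T : Path (⟨z, hz⟩ : (𝓡∂ (2 + 1)).boundary V) ⟨z, hz⟩ := (D.trackPath ⟨z, hz⟩).cast rfl h1.symm
  have hT : FundamentalGroup.fromPath (Path.Homotopic.Quotient.mk T) = y := by
    rw [Path.Homotopic.Quotient.eq.2 hhom, hγy]
  rw [hnat, FundamentalGroup.mapOfEq_eq_conj_of_homotopy F hψz T (fun t => rfl) a, hT, map_mul,
    map_mul, map_inv, hy]

/-! ### §2 Transfer of a based realisation to a boundary base point -/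

omit [SecondCountableTopology V] [ConnectedSpace V] in
/-- **Correcting a self-diffeomorphism fixing `x₀` to one fixing the boundary point `z`**, with
the induced automorphism of `π₁(V, z)` controlled up to an inner automorphism: compose with the
end stage of an ambient diffeotopy extending a point push of `∂V` taking `G z` back to `z`
(`BasePointTransfer.mapOfEq_comp_pathConj`).  (The `3`-dimensional copy of
`exists_diffeomorph_fix_boundaryPoint`, `HandleRealise.lean`.)
[cite: LaudenbachPoenaruBSMF1972, §2 (p. 339)] [cite: HirschDT1976, Ch. 8 §1 Thm. 1.3, §2]
[cite: HatcherAT2002, Lemma 1.19] -/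
theorem exists_diffeomorph_fix_boundaryPoint_of_dim_three (b : BoundaryData (𝓡∂ 3) V (𝓡 2))
    [ConnectedSpace b.carrier]
    (z₀ : b.carrier) {x₀ : V} (ζ : Path (b.incl z₀) x₀) (G : V ≃ₘ⟮𝓡∂ 3, 𝓡∂ 3⟯ V) (hG : G x₀ = x₀) :
    ∃ (G' : V ≃ₘ⟮𝓡∂ 3, 𝓡∂ 3⟯ V) (hG' : G' (b.incl z₀) = b.incl z₀) (X : FundamentalGroup V (b.incl z₀)),
      ∀ c : FundamentalGroup V x₀,
        FundamentalGroup.mapOfEq (⟨G', G'.continuous⟩ : C(V, V)) hG' (BasePointTransfer.pathConj ζ c) =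
          X⁻¹ * BasePointTransfer.pathConj ζ (FundamentalGroup.mapOfEq (⟨G, G.continuous⟩ : C(V, V)) hG c) * X := by
  haveI : T2Space b.carrier := b.isSmoothEmbedding.isEmbedding.t2Space
  haveI : CompactSpace b.carrier := b.compactSpace_carrier
  haveI : LocallyPathConnectedSpace b.carrier := ChartedSpace.locallyPathConnectedSpace (EuclideanSpace ℝ (Fin 2)) _
  haveI : PathConnectedSpace b.carrier := pathConnectedSpace_iff_connectedSpace.2 inferInstance
  -- `G z` is a boundary point `b.incl z₂`
  have hGz : G (b.incl z₀) ∈ (𝓡∂ 3).boundary V := by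
    rw [← G.image_boundary (by simp)]
    exact mem_image_of_mem _ (b.range_incl ▸ mem_range_self z₀)
  rw [← b.range_incl] at hGz
  obtain ⟨z₂, hz₂⟩ := hGz
  -- push `z₂` back to `z₀` inside the boundary, extend to an ambient diffeotopy
  obtain ⟨D, -, -, -, -, -, -, h1, -⟩ := exists_diffeotopy_apply_eq_trackPath_homotopic (n := 2)
    (PathConnectedSpace.somePath z₂ z₀) isOpen_univ (subset_univ _)
  obtain ⟨Gt, hGt⟩ := BoundaryData.exists_diffeotopy_comp_incl_eq_of_compactSpace 1 b D
  set ρ : V ≃ₘ⟮𝓡∂ 3, 𝓡∂ 3⟯ V := Gt.stage 1 with hρ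
  have hρz : ρ (G (b.incl z₀)) = b.incl z₀ := by
    rw [← hz₂]
    show Gt.toFun 1 (b.incl z₂) = b.incl z₀
    have := congrFun (hGt 1) z₂
    simp only [comp_apply] at this
    rw [this, h1]
  -- the homotopy from the identity to `ρ`
  let F : ContinuousMap.Homotopy (ContinuousMap.id V) (⟨ρ, ρ.continuous⟩ : C(V, V)) :=
    { toFun := fun p => Gt.toFun p.1 p.2
      continuous_toFun := Gt.contMDiff_uncurry_toFun.continuous.comp (continuous_subtype_val.prodMap continuous_id)
      map_zero_left := fun x => by show Gt.toFun 0 x = x; rw [Gt.toFun_zero]; rfl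
      map_one_left := fun x => rfl }
  -- the track of `G z` and the image of `ζ`
  let t : Path (G (b.incl z₀)) (b.incl z₀) :=
    { toFun := fun s => Gt.toFun s (G (b.incl z₀))
      continuous_toFun := Gt.contMDiff_uncurry_toFun.continuous.comp (continuous_subtype_val.prodMk continuous_const)
      source' := by show Gt.toFun 0 _ = _; rw [Gt.toFun_zero]; rfl
      target' := hρz }
  let A : Path (G (b.incl z₀)) x₀ := (ζ.map G.continuous).cast rfl hG.symm
  refine ⟨G.trans ρ, hρz, FundamentalGroup.fromPath (((Path.Homotopic.Quotient.mk t).symm.trans (Path.Homotopic.Quotient.mk A)).trans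
      (Path.Homotopic.Quotient.mk ζ).symm), fun c => ?_⟩
  exact BasePointTransfer.mapOfEq_comp_pathConj (⟨G, G.continuous⟩ : C(V, V)) (⟨ρ, ρ.continuous⟩ : C(V, V)) F hG hρz ζ
    t (fun s => rfl) A (fun s => rfl) c

/-! ### §3 Realisation of a generating set of `Aut π₁(V, z)` at a prescribed boundary point -/

set_option maxHeartbeats 3200000 in
/-- **REALISE∀ in dimension `3`.**  On every compact connected orientable smooth `3`-manifold `V`
with a handle decomposition with one `0`-handle and `k` `1`-handles, and for every boundary point
`z`, there are an isomorphism `e : π₁(V, z) ≅ F_k` and a generating set `S` of `Aut F_k` every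
element of which is induced, through `e`, by a self-diffeomorphism of `V` fixing `z`
(Laudenbach–Poénaru's proof of their Lemma 2, pp. 339–340, run in dimension `3`: the cores of the
`1`-handles give the basis, the slides and the flip of each handle realise the elementary Nielsen
automorphisms at an interior base point, the base point is moved to `z` at the cost of inner
automorphisms, which are realised at `z` by §1).
[cite: LaudenbachPoenaruBSMF1972, §2, Lemma 2 and its proof (pp. 339–340)]
[cite: GriffithsHB1964Handlebody, §§3–5] -/
theorem HasHandleDecomposition.exists_realise_autGenerators_of_dim_three (k : ℕ)
    (hk : HasHandleDecomposition 2 V (handleCount 1 k)) (ho : IsOrientable (𝓡∂ 3) V)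
    (z : V) (hzb : z ∈ (𝓡∂ 3).boundary V) :
    ∃ (e : FundamentalGroup V z ≃* FreeGroup (Fin k))
      (S : Set (MulAut (FreeGroup (Fin k)))), Subgroup.closure S = ⊤ ∧
      ∀ ν ∈ S, ∃ (G : V ≃ₘ⟮𝓡∂ 3, 𝓡∂ 3⟯ V) (hGz : G z = z),
        ∀ c : FundamentalGroup V z,
          FundamentalGroup.mapOfEq (⟨G, G.continuous⟩ : C(V, V)) hGz c = e.symm (ν (e c)) := by
  classical
  haveI : CompactSpace ((𝓡∂ (2 + 1)).boundary V) := compactSpace_boundary 2 V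
  haveI : LocallyPathConnectedSpace V := ChartedSpace.locallyPathConnectedSpace (EuclideanHalfSpace 3) V
  haveI : PathConnectedSpace V := pathConnectedSpace_iff_connectedSpace.2 inferInstance
  obtain ⟨oM⟩ := ho
  /- 1. Morse data -/
  obtain ⟨f, hf, hcount⟩ := hk
  obtain ⟨s, -, hF, hSf⟩ := hf.exists_isMorseFunction_ofBoundary
  obtain ⟨g, hg, hcrit, hind⟩ := Cobordism.Milnor1965_finalRearrangement_holds hF
  have hSg : ∀ j, criticalSetOfIndex (𝓡∂ (2 + 1)) g j = criticalSetOfIndex (𝓡∂ (2 + 1)) f j :=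
    fun j => (criticalSetOfIndex_congr hcrit hind j).trans (hSf j)
  have h0 : (criticalSetOfIndex (𝓡∂ (2 + 1)) g 0).ncard = 1 := by rw [hSg]; exact (hcount 0).trans (handleCount_zero 1 k)
  have h1 : (criticalSetOfIndex (𝓡∂ (2 + 1)) g 1).ncard = k := by rw [hSg]; exact (hcount 1).trans (handleCount_one 1 k)
  have h2 : ∀ j, 2 ≤ j → (criticalSetOfIndex (𝓡∂ (2 + 1)) g j).ncard = 0 := fun j hj => by
    rw [hSg]; exact (hcount j).trans (handleCount_of_two_le 1 k hj)
  have hgM : (Cobordism.ofBoundary 2 V).IsMorseFunction g := hg.1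
  have hfin : (criticalSet (𝓡∂ (2 + 1)) g).Finite := IsMorse.finite_criticalSet_holds hgM.isMorse
  have hidx : ∀ z ∈ criticalSet (𝓡∂ (2 + 1)) g, morseIndex (𝓡∂ (2 + 1)) g z ≤ 1 := by
    intro z hz
    by_contra hlt
    have h2le : 2 ≤ morseIndex (𝓡∂ (2 + 1)) g z := by omega
    have hmem : z ∈ criticalSetOfIndex (𝓡∂ (2 + 1)) g (morseIndex (𝓡∂ (2 + 1)) g z) := ⟨mem_criticalSet.1 hz, rfl⟩
    have hfin' : (criticalSetOfIndex (𝓡∂ (2 + 1)) g (morseIndex (𝓡∂ (2 + 1)) g z)).Finite :=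
      hfin.subset (criticalSetOfIndex_subset _ g _)
    rw [(Set.ncard_eq_zero hfin').1 (h2 _ h2le)] at hmem
    exact hmem
  obtain ⟨ξ, hξ⟩ := Cobordism.Milnor1965_exists_isGradientLike_holds hgM
  have hval : ∀ z ∈ criticalSet (𝓡∂ (2 + 1)) g, g z = Cobordism.niceLevel 2 (morseIndex (𝓡∂ (2 + 1)) g z) :=
    fun z hz => hg.2 z (mem_criticalSet.1 hz)
  /- 2. the ball and the cores of the `1`-handles; the basis of `π₁` -/
  obtain ⟨p₀, t₁, β, instP, Φ, hp₀, hgp₀, ht₁0, ht₁1, ht₁P, hβinj, hβrange, hcard, hΦinj, hΦrange, -, hΦB, hΦdisj, hsdr⟩ :=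
    hg.exists_ball_union_leftHandDiscs ξ hξ h0 h1 h2
  have hp₀val : g p₀ = Cobordism.niceLevel 2 0 := by
    have hp₀mem : p₀ ∈ criticalSetOfIndex (𝓡∂ (2 + 1)) g 0 := by rw [hp₀]; exact mem_singleton p₀
    rw [hval p₀ (mem_criticalSet.2 hp₀mem.1), hp₀mem.2]
  have ht₀' : Cobordism.niceLevel 2 0 < t₁ := hp₀val ▸ hgp₀
  have ht₁' : ∀ i : ↥(criticalSetOfIndex (𝓡∂ (2 + 1)) g 1), t₁ < Cobordism.niceLevel 2 1 := fun i => by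
    have h := ht₁P i.1 i.2
    have e1 : g i.1 = Cobordism.niceLevel 2 1 := (hval i.1 (mem_criticalSet.2 i.2.1)).trans (congrArg _ i.2.2)
    rwa [e1] at h
  -- the base point and the paths in the ball
  have h0B : (0 : EuclideanSpace ℝ (Fin (2 + 1))) ∈ closedBall (0 : EuclideanSpace ℝ (Fin (2 + 1))) 1 := mem_closedBall_self zero_le_one
  set x₀ : V := β ⟨0, h0B⟩ with hx₀def
  have hx₀B : x₀ ∈ range β := mem_range_self _
  have hends : ∀ (i : ↥(criticalSetOfIndex (𝓡∂ (2 + 1)) g 1)) (v : closedBall (0 : EuclideanSpace ℝ (Fin 1)) 1), ‖(v : EuclideanSpace ℝ (Fin 1))‖ = 1 →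
      ∃ y : closedBall (0 : EuclideanSpace ℝ (Fin (2 + 1))) 1, β y = Φ i v := fun i v hv => by
    obtain ⟨y, hy⟩ := (hΦB i v).2 hv; exact ⟨y, hy⟩
  -- the diameter of the model interval, and paths in the (convex) model ball
  obtain ⟨pP, pM, dγ, hplus, hanti, hdγinj, hdγrange⟩ := exists_path_antipodal_injective_range_eq_univ
  have hminus : ‖((pM : closedBall (0 : EuclideanSpace ℝ (Fin 1)) 1) : EuclideanSpace ℝ (Fin 1))‖ = 1 := by
    rw [hanti, norm_neg, hplus]
  haveI : PathConnectedSpace (closedBall (0 : EuclideanSpace ℝ (Fin (2 + 1))) 1) :=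
    isPathConnected_iff_pathConnectedSpace.mp
      ((convex_closedBall (0 : EuclideanSpace ℝ (Fin (2 + 1))) 1).isPathConnected ⟨0, h0B⟩)
  have hBle : ∀ x ∈ range β, g x ≤ t₁ := fun x hx => by
    have : x ∈ g ⁻¹' Iic t₁ := hβrange ▸ hx; exact this
  choose ym hym using fun i : ↥(criticalSetOfIndex (𝓡∂ (2 + 1)) g 1) => hends i pP hplus
  choose yp hyp using fun i : ↥(criticalSetOfIndex (𝓡∂ (2 + 1)) g 1) => hends i pM hminus
  set αm : ∀ i : ↥(criticalSetOfIndex (𝓡∂ (2 + 1)) g 1), Path x₀ (Φ i pP) := fun i =>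
    ((PathConnectedSpace.somePath (⟨0, h0B⟩ : closedBall (0 : EuclideanSpace ℝ (Fin (2 + 1))) 1) (ym i)).map
      β.continuous).cast rfl (hym i).symm with hαm
  set αp : ∀ i : ↥(criticalSetOfIndex (𝓡∂ (2 + 1)) g 1), Path x₀ (Φ i pM) := fun i =>
    ((PathConnectedSpace.somePath (⟨0, h0B⟩ : closedBall (0 : EuclideanSpace ℝ (Fin (2 + 1))) 1) (yp i)).map
      β.continuous).cast rfl (hyp i).symm with hαp
  have hαmB : ∀ i t, αm i t ∈ range β := fun i t => mem_range_self _
  have hαpB : ∀ i t, αp i t ∈ range β := fun i t => mem_range_self _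
  obtain ⟨eP, heP⟩ := exists_mulEquiv_apply_of_eq_arcLoop_of_isStrongDeformationRetractOf β hβinj
    (fun _ : ↥(criticalSetOfIndex (𝓡∂ (2 + 1)) g 1) => finrank_euclideanSpace_fin) Φ hΦB hΦinj hΦdisj hsdr (fun _ => pP) (fun _ => pM)
    (fun _ => hplus) (fun _ => hanti) (fun _ => dγ) hx₀B αm hαmB αp hαpB
  -- reindex by `Fin k`
  set eqv : ↥(criticalSetOfIndex (𝓡∂ (2 + 1)) g 1) ≃ Fin k := Fintype.equivFinOfCardEq hcard with heqv
  set e : FundamentalGroup V x₀ ≃* FreeGroup (Fin k) := eP.symm.trans (FreeGroup.freeGroupCongr eqv) with hedef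
  set Cq : ∀ i : ↥(criticalSetOfIndex (𝓡∂ (2 + 1)) g 1), Path (Φ i pP) (Φ i pM) := fun i => dγ.map (Φ i).continuous with hCq
  have he : ∀ i : ↥(criticalSetOfIndex (𝓡∂ (2 + 1)) g 1), e.symm (FreeGroup.of (eqv i)) =
      FundamentalGroup.fromPath (Path.Homotopic.Quotient.mk (((αm i).trans (Cq i)).trans (αp i).symm)) := fun i => by
    rw [hedef, MulEquiv.symm_trans_apply, FreeGroup.freeGroupCongr_symm, FreeGroup.freeGroupCongr_apply, FreeGroup.map.of,
      Equiv.symm_apply_apply, MulEquiv.symm_symm, heP i]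
  have he' : ∀ m : Fin k, e.symm (FreeGroup.of m) =
      FundamentalGroup.fromPath (Path.Homotopic.Quotient.mk (((αm (eqv.symm m)).trans (Cq (eqv.symm m))).trans (αp (eqv.symm m)).symm)) := fun m => by
    rw [← he, Equiv.apply_symm_apply]
  /- 3. the slides and the flip of every handle -/
  have hx₀t : g x₀ ≤ t₁ := hBle _ hx₀B
  have hCqinj : ∀ i, Injective (Cq i) := fun i => (hΦinj i).comp hdγinj
  have hCqrange : ∀ i : ↥(criticalSetOfIndex (𝓡∂ (2 + 1)) g 1), range (Cq i) = leftHandDisc (𝓡∂ (2 + 1)) g ξ i.1 t₁ := fun i => by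
    rw [← hΦrange i, hCq]
    show range (Φ i ∘ dγ) = _
    rw [range_comp, hdγrange, image_univ]
  have hCqstable : ∀ (j : ↥(criticalSetOfIndex (𝓡∂ (2 + 1)) g 1)) (z : (Cobordism.ofBoundary 2 V).W), z ∈ range (Cq j) →
      z ∈ stableSet (𝓡∂ (2 + 1)) ξ j.1 := fun j z hz => by
    rw [hCqrange j] at hz; exact hz.1
  have HR := fun i : ↥(criticalSetOfIndex (𝓡∂ (2 + 1)) g 1) => hg.handle_realise (le_refl 2) ξ hξ hidx h0 h2 i.2 ht₀' (ht₁' i) oM hx₀t (αm i) (αp i)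
    (fun t => hBle _ (hαmB i t)) (fun t => hBle _ (hαpB i t)) (Cq i) (hCqinj i) (hCqrange i)
  choose H hHinv hHmem hHslide hHflip using HR
  /- 4. the algebra: every elementary Nielsen automorphism is realised at `x₀` -/
  set R : Set (MulAut (FundamentalGroup V x₀)) :=
    {φ | ∃ (G : V ≃ₘ⟮𝓡∂ 3, 𝓡∂ 3⟯ V) (hG : G x₀ = x₀), ∀ c, φ c = FundamentalGroup.mapOfEq (⟨G, G.continuous⟩ : C(V, V)) hG c} with hR
  have hRmul : ∀ φ ∈ R, ∀ ψ ∈ R, φ * ψ ∈ R := by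
    rintro φ ⟨G₁, h₁, hφ⟩ ψ ⟨G₂, h₂, hψ⟩
    refine ⟨G₂.trans G₁, by show G₁ (G₂ x₀) = x₀; rw [h₂, h₁], fun c => ?_⟩
    rw [MulAut.mul_apply, hψ, hφ, mapOfEq_trans]
  have hRmem : ∀ (G : V ≃ₘ⟮𝓡∂ 3, 𝓡∂ 3⟯ V) (hG : G x₀ = x₀),
      ∃ A ∈ R, ∀ c, A c = FundamentalGroup.mapOfEq (⟨G, G.continuous⟩ : C(V, V)) hG c := fun G hG => by
    obtain ⟨A, hA⟩ := exists_mulAut_apply_eq_mapOfEq G hG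
    exact ⟨A, ⟨G, hG, hA⟩, hA⟩
  -- the loops of the other handles lie below the seed collar of the handle `i`
  have hother : ∀ i j : ↥(criticalSetOfIndex (𝓡∂ (2 + 1)) g 1), j ≠ i → ∀ t, g ((((αm j).trans (Cq j)).trans (αp j).symm) t) ≤ t₁ ∨
      ∃ q' ∈ criticalSet (𝓡∂ (2 + 1)) g, q' ≠ i.1 ∧ (((αm j).trans (Cq j)).trans (αp j).symm) t ∈ stableSet (𝓡∂ (2 + 1)) ξ q' := by
    intro i j hji t
    rw [Path.trans_apply]
    split_ifs with h₁
    · rw [Path.trans_apply]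
      split_ifs with h₂
      · exact Or.inl (hBle _ (hαmB _ _))
      · right
        exact ⟨j.1, mem_criticalSet.2 j.2.1, fun h => hji (Subtype.ext h), hCqstable j _ (mem_range_self _)⟩
    · exact Or.inl (by rw [Path.symm_apply]; exact hBle _ (hαpB _ _))
  have REAL₀ := RealiseAlgebra.forall_nielsen_mem_of_slides_flips e R hRmul (fun m => H (eqv.symm m))
    (fun m m' hmm' => by rw [he' m']; exact hHmem _ _ (hother _ _ fun h => hmm' (by rw [← Equiv.apply_symm_apply eqv m', h, Equiv.apply_symm_apply])))
    (fun m => hHinv _)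
    (fun m => by
      rcases hHslide (eqv.symm m) with hA | hB
      · left
        intro w hw
        obtain ⟨G, hG, hfix, hx⟩ := hA w hw
        obtain ⟨A, hAR, hAe⟩ := hRmem G hG
        exact ⟨A, hAR, fun w' hw' => by rw [hAe]; exact hfix w' hw', by rw [hAe, he' m]; exact hx⟩
      · right
        intro w hw
        obtain ⟨G, hG, hfix, hx⟩ := hB w hw
        obtain ⟨A, hAR, hAe⟩ := hRmem G hG
        exact ⟨A, hAR, fun w' hw' => by rw [hAe]; exact hfix w' hw', by rw [hAe, he' m]; exact hx⟩)
    (fun m => by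
      obtain ⟨G, hG, u, hu, v, hv, hfix, hx⟩ := hHflip (eqv.symm m)
      obtain ⟨A, hAR, hAe⟩ := hRmem G hG
      exact ⟨A, hAR, u, hu, v, hv, fun w' hw' => by rw [hAe]; exact hfix w' hw', by rw [hAe, he' m]; exact hx⟩)
  /- 5. the boundary base point -/
  set b : BoundaryData (𝓡∂ 3) V (𝓡 2) := BoundaryManifold.boundaryData 2 V with hb
  have hkV : HasHandleDecomposition 2 V (handleCount 1 k) := ⟨f, hf, hcount⟩
  have hV : IsHandlebody k V := ⟨inferInstance, inferInstance, ⟨oM⟩, hkV⟩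
  haveI : ConnectedSpace b.carrier := IsHandlebody.connectedSpace_boundary_holds k V hV b
  let z₀ : b.carrier := ⟨z, hzb⟩
  -- work at `b.incl z₀` (which is `z`), to keep the base point syntactically an image of `b.incl`
  suffices KEY : ∃ (e' : FundamentalGroup V (b.incl z₀) ≃* FreeGroup (Fin k))
      (S : Set (MulAut (FreeGroup (Fin k)))), Subgroup.closure S = ⊤ ∧
      ∀ ν ∈ S, ∃ (G : V ≃ₘ⟮𝓡∂ 3, 𝓡∂ 3⟯ V) (hGz : G (b.incl z₀) = b.incl z₀),
        ∀ c : FundamentalGroup V (b.incl z₀),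
          FundamentalGroup.mapOfEq (⟨G, G.continuous⟩ : C(V, V)) hGz c = e'.symm (ν (e' c)) by
    exact KEY
  set z' : V := b.incl z₀ with hz'
  have hz'b : z' ∈ (𝓡∂ 3).boundary V := b.incl_mem_boundary z₀
  set ζ : Path z' x₀ := PathConnectedSpace.somePath z' x₀ with hζ
  set T : FundamentalGroup V x₀ ≃* FundamentalGroup V z' := BasePointTransfer.pathConj ζ with hT
  set ez : FundamentalGroup V z' ≃* FreeGroup (Fin k) := T.symm.trans e with hez
  set Sz : Set (MulAut (FreeGroup (Fin k))) :=
    {θ | ∃ (G : V ≃ₘ⟮𝓡∂ 3, 𝓡∂ 3⟯ V) (hGz : G z' = z'), ∀ c, FundamentalGroup.mapOfEq (⟨G, G.continuous⟩ : C(V, V)) hGz c = ez.symm (θ (ez c))}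
    with hSz
  -- inner automorphisms are realised at `z'`
  have hinner : ∀ w : FreeGroup (Fin k), MulAut.conj w ∈ Sz := fun w => by
    obtain ⟨G, hGz, hG⟩ := exists_diffeomorph_mapOfEq_eq_conj_of_dim_three hkV z' hz'b (ez.symm w)
    refine ⟨G, hGz, fun c => ?_⟩
    rw [hG c, MulAut.conj_apply, map_mul, map_mul, map_inv, MulEquiv.symm_apply_apply]
  -- the Nielsen automorphisms are realised at `z'` up to inner automorphisms
  have hniel : ∀ ν ∈ nielsenGenerators k, ∃ d : FreeGroup (Fin k), MulAut.conj d * ν ∈ Sz := by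
    intro ν hν
    obtain ⟨φ, ⟨G, hG, hφ⟩, hν⟩ := REAL₀ ν hν
    obtain ⟨G', hG', X, hX⟩ := exists_diffeomorph_fix_boundaryPoint_of_dim_three b z₀ ζ G hG
    refine ⟨(ez X)⁻¹, G', hG', fun c => ?_⟩
    obtain ⟨c, rfl⟩ : ∃ c₀, T c₀ = c := T.surjective c
    have h3 : ∀ y, ez.symm y = T (e.symm y) := fun y => rfl
    have h4 : ez (T c) = e c := by show e (T.symm (T c)) = e c; rw [MulEquiv.symm_apply_apply]
    have h5 : T (e.symm (ez X)) = X := by rw [← h3, MulEquiv.symm_apply_apply]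
    rw [hX c, ← hφ c, hν c, MulAut.mul_apply, MulAut.conj_apply, h4, inv_inv, h3, map_mul, map_mul, map_mul, map_mul,
      map_inv, map_inv, h5]
  refine ⟨ez, Sz, ?_, ?_⟩
  · exact closure_eq_top_of_conj_mul_nielsen_mem Sz (fun i => Subgroup.subset_closure (hinner _))
      fun ν hν => by obtain ⟨d, hd⟩ := hniel ν hν; exact ⟨d, Subgroup.subset_closure hd⟩
  · rintro ν ⟨G, hGz, hG⟩
    exact ⟨G, hGz, hG⟩

/-! ### §4 All automorphisms -/

/-- **Every automorphism of `π₁(V, z)` of a `3`-dimensional `1`-handlebody is induced by a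
self-diffeomorphism fixing the boundary point `z`** (Zieschang 1964; Griffiths 1964, §§3–5): the
automorphisms so induced form a subgroup of `Aut π₁(V, z)` (composition: `(G₁ ∘ G₂)_# = (G₁)_# ∘ (G₂)_#`;
inverse: `G⁻¹`), which by §3 contains the `e`-transport of a generating set of `Aut F_k`.
[cite: GriffithsHB1964Handlebody, §§3–5] [cite: LaudenbachPoenaruBSMF1972, §2, Lemma 2] -/
theorem HasHandleDecomposition.exists_diffeomorph_mapOfEq_eq_of_dim_three {k : ℕ}
    (hk : HasHandleDecomposition 2 V (handleCount 1 k)) (ho : IsOrientable (𝓡∂ 3) V)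
    (z : V) (hzb : z ∈ (𝓡∂ 3).boundary V) (θ : FundamentalGroup V z ≃* FundamentalGroup V z) :
    ∃ (G : V ≃ₘ⟮𝓡∂ 3, 𝓡∂ 3⟯ V) (hGz : G z = z),
      ∀ c : FundamentalGroup V z,
        FundamentalGroup.mapOfEq (⟨G, G.continuous⟩ : C(V, V)) hGz c = θ c := by
  obtain ⟨e, S, hS, hreal⟩ := hk.exists_realise_autGenerators_of_dim_three k ho z hzb
  -- the subgroup of `Aut F_k` of automorphisms realised (through `e`) by based diffeomorphisms
  let Rz : Subgroup (MulAut (FreeGroup (Fin k))) :=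
    { carrier := {ν | ∃ (G : V ≃ₘ⟮𝓡∂ 3, 𝓡∂ 3⟯ V) (hGz : G z = z),
        ∀ c : FundamentalGroup V z,
          FundamentalGroup.mapOfEq (⟨G, G.continuous⟩ : C(V, V)) hGz c = e.symm (ν (e c))}
      one_mem' := ⟨Diffeomorph.refl _ V ∞, rfl, fun c => by
        rw [MulAut.one_apply, MulEquiv.symm_apply_apply]
        exact mapOfEq_eq_self_of_forall_eq _ _ (fun x => rfl) c⟩
      mul_mem' := by
        rintro ν₁ ν₂ ⟨G₁, h₁, hG₁⟩ ⟨G₂, h₂, hG₂⟩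
        refine ⟨G₂.trans G₁, by show G₁ (G₂ z) = z; rw [h₂, h₁], fun c => ?_⟩
        have h := mapOfEq_trans G₁ G₂ h₁ h₂ c
        rw [hG₂, hG₁, MulEquiv.apply_symm_apply] at h
        rw [MulAut.mul_apply]
        exact h.symm
      inv_mem' := by
        rintro ν ⟨G, hG, hGν⟩
        have hG' : G.symm z = z := by
          have h := congrArg G.symm hG; rw [G.symm_apply_apply] at h; exact h.symm
        refine ⟨G.symm, hG', fun c => ?_⟩
        -- `G_# (G⁻¹_# c) = c` and `G_#` is `e⁻¹ ν e`, so `G⁻¹_# c = e⁻¹ ν⁻¹ e c`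
        have hcomp : FundamentalGroup.mapOfEq (⟨G, G.continuous⟩ : C(V, V)) hG
            (FundamentalGroup.mapOfEq (⟨G.symm, G.symm.continuous⟩ : C(V, V)) hG' c) = c := by
          rw [mapOfEq_trans G G.symm hG hG' c]
          exact mapOfEq_eq_self_of_forall_eq _ _ (fun x => G.apply_symm_apply x) c
        rw [hGν] at hcomp
        have h2 : ν (e (FundamentalGroup.mapOfEq (⟨G.symm, G.symm.continuous⟩ : C(V, V)) hG' c)) = e c := by
          have := congrArg e hcomp
          rwa [MulEquiv.apply_symm_apply] at this
        have h3 : e (FundamentalGroup.mapOfEq (⟨G.symm, G.symm.continuous⟩ : C(V, V)) hG' c) = ν⁻¹ (e c) := by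
          rw [← h2, MulAut.inv_apply_self]
        rw [← h3, MulEquiv.symm_apply_apply] }
  have hle : Subgroup.closure S ≤ Rz := (Subgroup.closure_le Rz).2 fun ν hν => hreal ν hν
  rw [hS, top_le_iff] at hle
  -- `θ` transported to `F_k` lies in `Rz = ⊤`
  have hθ : (e.symm.trans θ).trans e ∈ Rz := by
    have : ((e.symm.trans θ).trans e : MulAut (FreeGroup (Fin k))) ∈ (⊤ : Subgroup (MulAut (FreeGroup (Fin k)))) :=
      Subgroup.mem_top _
    rw [← hle] at this
    exact this
  obtain ⟨G, hGz, hG⟩ := hθ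
  refine ⟨G, hGz, fun c => ?_⟩
  rw [hG c]
  show e.symm (e (θ (e.symm (e c)))) = θ c
  rw [MulEquiv.symm_apply_apply, MulEquiv.symm_apply_apply]

/-- **Every automorphism of the fundamental group of a genus-`g` handlebody at a boundary point is
induced by a self-diffeomorphism of the handlebody fixing that point** (Zieschang 1964; Griffiths
1964, §§3–5; Hensel (2020), Thm. 6.2), `IsHandlebody` form.
[cite: GriffithsHB1964Handlebody, §§3–5] [cite: Hensel2020HandlebodyPrimer, Thm. 6.2] -/
theorem IsHandlebody.exists_diffeomorph_mapOfEq_eq {g : ℕ} {H : Type u} [TopologicalSpace H]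
    [T2Space H] [SecondCountableTopology H] [ChartedSpace (EuclideanHalfSpace 3) H]
    [IsManifold (𝓡∂ 3) ∞ H] (hH : IsHandlebody g H)
    (z : H) (hzb : z ∈ (𝓡∂ 3).boundary H) (θ : FundamentalGroup H z ≃* FundamentalGroup H z) :
    ∃ (G : H ≃ₘ⟮𝓡∂ 3, 𝓡∂ 3⟯ H) (hGz : G z = z),
      ∀ c : FundamentalGroup H z,
        FundamentalGroup.mapOfEq (⟨G, G.continuous⟩ : C(H, H)) hGz c = θ c := by
  haveI := hH.compactSpace
  haveI := hH.connectedSpace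
  exact hH.hasHandleDecomposition.exists_diffeomorph_mapOfEq_eq_of_dim_three hH.isOrientable z hzb θ

end Literature.Topology.FourManifolds

end
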